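import Summits.QuantumFields.YangMills.Theorems.SwapVirialDeficitGnomonicTaylorChordLine
import Summits.QuantumFields.YangMills.Theorems.SwapVirialDeficitGnomonicTaylorFour
import Summits.QuantumFields.YangMills.Theorems.SwapVirialDeficitBlowUpGnomonicCartHubDefs
import HarnessLib

/-!
# Route `SwapVirialDeficit` (YangMills): THE FIXED-FRAME DEFICIT IS QUADRATICALLY FLAT IN THE HUB AT A FLAT POINT — `F̂cart(a′, η) ≤ 642432·L⁴·‖a′ − A‖²` when `F̂cart(A, η) = 0`
# (cell ym-idea-1, skeleton ➎ v14, `stub_core_tip`: step (1) of w3 g68's p-UNIFORM soft-pair ceiling (E1′) — hub-axis covariance instead of size-normalised letter jets;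
# free-hands support of ⟨stmt-QuantumFields-24197⟩ `SwapVirialDeficit.SwapGluedStiffness`)

In w2 g60's fixed-frame chart ✓`gnoDeficitCart z χ a ε η` the hub link is `a/‖a‖` itself and the LETTERS are unit quaternions — compact, no gnomonic metric.  Along the hub CHORD
`s ↦ A + s(a′ − A)` between unit hubs `A, a′` with `‖a′ − A‖ ≤ 1`, at FIXED letters, every leader carries a 4-jet of size `≤ 4‖a′ − A‖` (hub unit by ✓`jet4_chord_line`, slaved
letter `r̄·x̂·r·ẑ` by ✓`jet4_star` ∕ ✓`jet4_mul`, the other letters constant) UNIFORMLY IN THE LETTERS, so the K7 machine (✓`jet4_fixHistory`, ✓`realJet4_qDeficit_le`) bounds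
`|ψ″| ≤ 816L⁴(4‖a′−A‖)²`, `|ψ‴| ≤ 19872L⁴(4‖a′−A‖)³` for `ψ(s) = F̂cart(A + s(a′−A), η)`.  If `F̂cart(A, η) = 0` then `s = 0` is a minimum (`F̂cart ≥ 0`), `ψ′(0) = 0`, and the
third-order Taylor remainder (✓`abs_taylor_three_remainder_le`) gives
★★ `gnoDeficitCart_le_sq_of_flat` — `F̂cart_{z,χ}(a′, ε, η) ≤ 642432·L⁴·‖a′ − A‖²` for unit `A, a′`, `‖a′ − A‖ ≤ 1`, ANY `η` with `F̂cart_{z,χ}(A, ε, η) = 0`.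
(Sequel: with ✓`gnoDeficitCart_gnoRot` the letter-rotation orbit of a flat base at the standard hub is this chord picture with `‖a′ − A‖ ≤ sin θ·(tilt)`, giving the
soft-pair ceiling `Q_{angUnit θ}(soft) ≲ L⁴ sin²θ` uniformly in the base point — the END-uniform input of the tip sandwich.)

HONEST LABEL: calculus on landed jets; `stub_core_tip`, ⟨24197⟩ ∕ ⟨24194⟩ OPEN; own crux ⟨22884⟩ `LargeFieldMassRefinementTail` OPEN (blocked-on ⟨19935⟩); the Yang–Mills mass
gap is NOT proved; no summit is proved by a line.  THEOREMS ONLY (0 `def`, 0 `sorry`, no instance), standard axioms.  Width seat ym-line-sfw-p2-w3 g68 (cell ym-idea-1, free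
hands), `--supports stmt-QuantumFields-24197`.  References: [cite: Luscher1983, §2]; [folklore].
-/

set_option autoImplicit false

noncomputable section

open Quaternion Set Metric Module
open scoped Quaternion RealInnerProductSpace InnerProductSpace BigOperators ContDiff
open Literature.MathematicalPhysics.QuantumLattice
open Literature.MathematicalPhysics.QuantumFieldTheory hiding SU2
open Literature.Analysis.Calculus (radialUnit radialUnit_def norm_radialUnit)
open Summit.QuantumFields.YangMills.Theorems.FemtoTransferGap
open Summit.QuantumFields.YangMills.Theorems.FemtoTransferGap.TT
open Summit.QuantumFields.YangMills.Theorems.SwapVirialDeficit.ZeroModeSigma (su2Quat_quatToSU2_eq_radialUnit slaveP slaveP_def norm_slaveP)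
open Summit.QuantumFields.YangMills.Theorems.SwapVirialDeficit.BlowUp (qDeficit swapRingDeficit_eq_qDeficit)
open Summit.QuantumFields.YangMills.Theorems.SwapVirialDeficit.BlowUpRing

namespace Summit.QuantumFields.YangMills.Theorems.SwapVirialDeficit.Gnomonic

variable {L : ℕ} [NeZero L]

/-- `radialUnit` fixes unit vectors. [folklore] -/
theorem radialUnit_of_norm_eq_one {x : ℍ} (hx : ‖x‖ = 1) : radialUnit x = x := by
  rw [radialUnit_def, hx, inv_one, one_smul]

set_option maxHeartbeats 400000 in
/-- ★ **FOUR DERIVATIVE WITNESSES OF THE FIXED-FRAME DEFICIT ALONG A HUB CHORD AT FIXED LETTERS**: for unit `A, a′` with `‖a′ − A‖ ≤ 1` and any letters `η`,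
`ψ(s) = F̂cart_{z,χ}(A + s(a′−A), ε, η)` has `|ψ′| ≤ 144L⁴M`, `|ψ″| ≤ 816L⁴M²`, `|ψ‴| ≤ 19872L⁴M³`, `|ψ⁗| ≤ 609984L⁴M⁴` with `M = 4‖a′ − A‖` — UNIFORMLY IN `η`
(the letters are constant unit quaternions; ✓`jet4_chord_line`, ✓`jet4_fixHistory`, ✓`realJet4_qDeficit_le`). [cite: Luscher1983, §2] -/
theorem realJet4_gnoDeficitCart_chord_le (z : Fin 3 → Bool) (χ : Site 3 L → SU2) {A a' : ℍ} (hA : ‖A‖ = 1) (ha' : ‖a'‖ = 1) (hd : ‖a' - A‖ ≤ 1)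
    (ε : GnoSign L) (η : GnoCoord L) :
    ∃ d₁ d₂ d₃ d₄ : ℝ → ℝ, (∀ s, HasDerivAt (fun s : ℝ => gnoDeficitCart z χ (A + s • (a' - A)) ε η) (d₁ s) s) ∧
      (∀ s, HasDerivAt d₁ (d₂ s) s) ∧ (∀ s, HasDerivAt d₂ (d₃ s) s) ∧ (∀ s, HasDerivAt d₃ (d₄ s) s) ∧
      ∀ s, |d₁ s| ≤ 144 * (L : ℝ) ^ 4 * (4 * ‖a' - A‖) ∧ |d₂ s| ≤ 816 * (L : ℝ) ^ 4 * (4 * ‖a' - A‖) ^ 2 ∧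
        |d₃ s| ≤ 19872 * (L : ℝ) ^ 4 * (4 * ‖a' - A‖) ^ 3 ∧ |d₄ s| ≤ 609984 * (L : ℝ) ^ 4 * (4 * ‖a' - A‖) ^ 4 := by
  set d : ℍ := a' - A with hdd
  have hd0 : 0 ≤ ‖d‖ := norm_nonneg _
  -- the hub chord avoids the origin
  have hne : ∀ s : ℝ, A + s • d ≠ 0 := fun s h => by
    have h1 := three_quarters_le_norm_sq_chord_smul hA ha' hd 1 s
    rw [one_smul, ← hdd, h, norm_zero] at h1; norm_num at h1
  have hr1 : ∀ s : ℝ, ‖radialUnit (A + s • d)‖ = 1 := fun s => norm_radialUnit (hne s)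
  -- the hub unit along the chord (✓`jet4_chord_line` with `c = 1`, `t₀ = 0`, `t₁ = 1`)
  have hchord : ∃ f₁ f₂ f₃ f₄ : ℝ → ℍ, (∀ s, HasDerivAt (fun s : ℝ => radialUnit (A + s • d)) (f₁ s) s) ∧ (∀ s, HasDerivAt f₁ (f₂ s) s) ∧
      (∀ s, HasDerivAt f₂ (f₃ s) s) ∧ (∀ s, HasDerivAt f₃ (f₄ s) s) ∧
      ∀ s, ‖radialUnit (A + s • d)‖ ≤ 1 ∧ ‖f₁ s‖ ≤ 2 * ‖d‖ ∧ ‖f₂ s‖ ≤ (2 * ‖d‖) ^ 2 ∧ ‖f₃ s‖ ≤ 3 * (2 * ‖d‖) ^ 3 ∧ ‖f₄ s‖ ≤ 9 * (2 * ‖d‖) ^ 4 := by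
    obtain ⟨f₁, f₂, f₃, f₄, k₁, k₂, k₃, k₄, kb⟩ := jet4_chord_line hA ha' hd 1 0 1
    have e : (fun s : ℝ => radialUnit ((A + (0 : ℝ) • ((1 : ℝ) • (a' - A))) + s • ((1 : ℝ) • ((1 : ℝ) • (a' - A))))) = fun s : ℝ => radialUnit (A + s • d) := by
      funext s; simp only [one_smul, zero_smul, add_zero, hdd]
    have e2 : 2 * |(1 : ℝ)| * ‖(1 : ℝ) • (a' - A)‖ = 2 * ‖d‖ := by rw [abs_one, one_smul, mul_one, hdd]
    rw [e] at k₁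
    refine ⟨f₁, f₂, f₃, f₄, k₁, k₂, k₃, k₄, fun s => ⟨(hr1 s).le, ?_⟩⟩
    have hb := (kb s).2
    rw [e2] at hb
    exact hb
  -- the letters (constant unit quaternions)
  set x : ℍ := gnoLetter ε.1.1 η.1.1 with hx
  set y : ℍ := gnoLetter ε.1.2 η.1.2 with hy
  set w : ℍ := gnoLetter ε.2.1 η.2.1 with hw
  have hx0 : x ≠ 0 := gnoLetter_ne_zero _ _
  have hy0 : y ≠ 0 := gnoLetter_ne_zero _ _
  have hw0 : w ≠ 0 := gnoLetter_ne_zero _ _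
  have hconst : ∀ {v : ℍ}, v ≠ 0 → ∃ f₁ f₂ f₃ f₄ : ℝ → ℍ, (∀ t, HasDerivAt (fun _ : ℝ => su2Quat (quatToSU2 v)) (f₁ t) t) ∧ (∀ t, HasDerivAt f₁ (f₂ t) t) ∧
      (∀ t, HasDerivAt f₂ (f₃ t) t) ∧ (∀ t, HasDerivAt f₃ (f₄ t) t) ∧
      ∀ t, ‖su2Quat (quatToSU2 v)‖ ≤ 1 ∧ ‖f₁ t‖ ≤ 0 ∧ ‖f₂ t‖ ≤ (0 : ℝ) ^ 2 ∧ ‖f₃ t‖ ≤ 3 * (0 : ℝ) ^ 3 ∧ ‖f₄ t‖ ≤ 9 * (0 : ℝ) ^ 4 :=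
    fun {v} _ => jet4_const (su2Quat (quatToSU2 v)) (le_of_eq (norm_su2Quat _)) le_rfl
  -- the leaders
  have hC : ∀ μ : Fin 4, ∃ f₁ f₂ f₃ f₄ : ℝ → ℍ,
      (∀ s, HasDerivAt (fun s : ℝ => su2Quat ((cartPoint (A + s • d) ε η).1 μ)) (f₁ s) s) ∧
      (∀ s, HasDerivAt f₁ (f₂ s) s) ∧ (∀ s, HasDerivAt f₂ (f₃ s) s) ∧ (∀ s, HasDerivAt f₃ (f₄ s) s) ∧
      ∀ s, ‖su2Quat ((cartPoint (A + s • d) ε η).1 μ)‖ ≤ 1 ∧ ‖f₁ s‖ ≤ 4 * ‖d‖ ∧ ‖f₂ s‖ ≤ (4 * ‖d‖) ^ 2 ∧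
        ‖f₃ s‖ ≤ 3 * (4 * ‖d‖) ^ 3 ∧ ‖f₄ s‖ ≤ 9 * (4 * ‖d‖) ^ 4 := by
    intro μ
    match μ with
    | ⟨0, _⟩ => exact jet4_mono le_rfl (by positivity : (0 : ℝ) ≤ 4 * ‖d‖) (hconst hx0)
    | ⟨1, _⟩ =>
      -- the slaved letter `r̄(s)·x̂·r(s)·ẑ` with the hub unit MOVING ON THE CHORD
      have h3 := jet4_mul (by positivity) le_rfl
        (jet4_mul (by positivity) (by positivity) (jet4_mul (by positivity) le_rfl (jet4_star hchord) (hconst hx0)) hchord) (hconst hw0)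
      have e : ∀ s : ℝ, star (radialUnit (A + s • d)) * su2Quat (quatToSU2 x) * radialUnit (A + s • d) * su2Quat (quatToSU2 w) =
          su2Quat ((cartPoint (A + s • d) ε η).1 ⟨1, by omega⟩) := fun s =>
        (su2Quat_quatToSU2_slaveP_mul (hr1 s) hx0 hw0).symm
      have h := jet4_mono (by positivity) (show 2 * ‖d‖ + 0 + 2 * ‖d‖ + 0 ≤ 4 * ‖d‖ by linarith) h3
      simpa only [e] using h
    | ⟨2, _⟩ => exact jet4_mono le_rfl (by positivity : (0 : ℝ) ≤ 4 * ‖d‖) (hconst hy0)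
    | ⟨3, _⟩ =>
      have e : ∀ s : ℝ, radialUnit (A + s • d) = su2Quat ((cartPoint (A + s • d) ε η).1 ⟨3, by omega⟩) := fun s => by
        show radialUnit (A + s • d) = su2Quat (quatToSU2 (radialUnit (A + s • d)))
        rw [su2Quat_quatToSU2_eq_radialUnit (radialUnit_ne_zero' (hne s)), radialUnit_of_norm_eq_one (hr1 s)]
      have h := jet4_mono (by positivity) (show 2 * ‖d‖ ≤ 4 * ‖d‖ by linarith) hchord
      simpa only [e] using h
  -- the followers (constant)
  have hU : ∀ i : Fol L, ∃ f₁ f₂ f₃ f₄ : ℝ → ℍ,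
      (∀ s, HasDerivAt (fun s : ℝ => su2Quat ((cartPoint (A + s • d) ε η).2 i)) (f₁ s) s) ∧
      (∀ s, HasDerivAt f₁ (f₂ s) s) ∧ (∀ s, HasDerivAt f₂ (f₃ s) s) ∧ (∀ s, HasDerivAt f₃ (f₄ s) s) ∧
      ∀ s, ‖su2Quat ((cartPoint (A + s • d) ε η).2 i)‖ ≤ 1 ∧ ‖f₁ s‖ ≤ 0 ∧ ‖f₂ s‖ ≤ (0 : ℝ) ^ 2 ∧
        ‖f₃ s‖ ≤ 3 * (0 : ℝ) ^ 3 ∧ ‖f₄ s‖ ≤ 9 * (0 : ℝ) ^ 4 := fun i => hconst (gnoLetter_ne_zero _ _)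
  -- the words and the deficit
  obtain ⟨hl, hs⟩ := jet4_fixHistory (C := fun s => (cartPoint (L := L) (A + s • d) ε η).1) (U := fun s => (cartPoint (L := L) (A + s • d) ε η).2) χ
    (by positivity : (0 : ℝ) ≤ 4 * ‖d‖) le_rfl hC hU
  have e4 : 4 * ‖d‖ + 0 + 0 = 4 * ‖d‖ := by ring
  rw [e4] at hl hs
  have h := realJet4_qDeficit_le (L := L) z (M := 4 * ‖d‖) (by positivity)
    (Q := fun s => ((fun (i : Fin (2 * L - 1 + 1)) (e : Edge 3 L) =>
        su2Quat ((fixHistory (ringConfig χ ((cartPoint (L := L) (A + s • d) ε η).1, (cartPoint (L := L) (A + s • d) ε η).2))).1 i e)),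
      fun q : Site 3 L => su2Quat ((fixHistory (ringConfig χ ((cartPoint (L := L) (A + s • d) ε η).1, (cartPoint (L := L) (A + s • d) ε η).2))).2 q)))
    (fun i e => hl i e) (fun q => hs q)
  have e : (fun s : ℝ => gnoDeficitCart z χ (A + s • d) ε η) = fun s => qDeficit z
      ((fun (i : Fin (2 * L - 1 + 1)) (e : Edge 3 L) =>
        su2Quat ((fixHistory (ringConfig χ ((cartPoint (L := L) (A + s • d) ε η).1, (cartPoint (L := L) (A + s • d) ε η).2))).1 i e)),
      fun q : Site 3 L => su2Quat ((fixHistory (ringConfig χ ((cartPoint (L := L) (A + s • d) ε η).1, (cartPoint (L := L) (A + s • d) ε η).2))).2 q)) :=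
    funext fun s => swapRingDeficit_eq_qDeficit z _
  rw [e]
  exact h

/-- ★★ **THE FIXED-FRAME DEFICIT IS QUADRATICALLY FLAT IN THE HUB AT A FLAT POINT**: for unit hubs `A, a′` with `‖a′ − A‖ ≤ 1` and letters `η` at which the hub `A` is flat
(`F̂cart_{z,χ}(A, ε, η) = 0`), `F̂cart_{z,χ}(a′, ε, η) ≤ 642432·L⁴·‖a′ − A‖²` — uniformly in `η` (minimum at `s = 0` ⟹ `ψ′(0) = 0`; `ψ″ ≤ 816L⁴M²`, third-order remainder
`≤ 19872L⁴M³/2`, `M = 4‖a′−A‖ ≤ 4`). [cite: Luscher1983, §2] -/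
theorem gnoDeficitCart_le_sq_of_flat (z : Fin 3 → Bool) (χ : Site 3 L → SU2) {A a' : ℍ} (hA : ‖A‖ = 1) (ha' : ‖a'‖ = 1) (hd : ‖a' - A‖ ≤ 1)
    (ε : GnoSign L) (η : GnoCoord L) (h0 : gnoDeficitCart z χ A ε η = 0) :
    gnoDeficitCart z χ a' ε η ≤ 642432 * (L : ℝ) ^ 4 * ‖a' - A‖ ^ 2 := by
  obtain ⟨d₁, d₂, d₃, d₄, h₁, h₂, h₃, h₄, hb⟩ := realJet4_gnoDeficitCart_chord_le z χ hA ha' hd ε η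
  set M : ℝ := 4 * ‖a' - A‖ with hM
  have hM0 : 0 ≤ M := by positivity
  have hM4 : M ≤ 4 := by rw [hM]; linarith
  have hL : (0 : ℝ) ≤ (L : ℝ) ^ 4 := by positivity
  -- values at the ends of the chord
  have e0 : gnoDeficitCart z χ (A + (0 : ℝ) • (a' - A)) ε η = 0 := by
    rw [zero_smul, add_zero]; exact h0
  have e1 : gnoDeficitCart z χ (A + (1 : ℝ) • (a' - A)) ε η = gnoDeficitCart z χ a' ε η := by
    rw [one_smul, add_sub_cancel]
  -- `s = 0` is a minimum, so `ψ′(0) = 0`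
  have hmin : IsLocalMin (fun s : ℝ => gnoDeficitCart z χ (A + s • (a' - A)) ε η) 0 :=
    Filter.Eventually.of_forall fun s => by
      show gnoDeficitCart z χ (A + (0 : ℝ) • (a' - A)) ε η ≤ gnoDeficitCart z χ (A + s • (a' - A)) ε η
      rw [e0]; exact gnoDeficitCart_nonneg z χ _ ε η
  have hd1 : d₁ 0 = 0 := hmin.hasDerivAt_eq_zero (h₁ 0)
  -- third-order Taylor remainder on `[0, 1]`
  have hrem := abs_taylor_three_remainder_le h₁ h₂ h₃ (M := 19872 * (L : ℝ) ^ 4 * M ^ 3) (fun s _ => (hb s).2.2.1)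
  rw [e0, e1, hd1] at hrem
  have h2 : d₂ 0 ≤ 816 * (L : ℝ) ^ 4 * M ^ 2 := (le_abs_self _).trans (hb 0).2.1
  have hlin := (abs_le.1 hrem).2
  have hM3 : M ^ 3 ≤ 4 * M ^ 2 := by nlinarith [sq_nonneg M]
  calc gnoDeficitCart z χ a' ε η ≤ 816 * (L : ℝ) ^ 4 * M ^ 2 / 2 + 19872 * (L : ℝ) ^ 4 * M ^ 3 / 2 := by linarith
    _ ≤ 816 * (L : ℝ) ^ 4 * M ^ 2 / 2 + 19872 * (L : ℝ) ^ 4 * (4 * M ^ 2) / 2 := by gcongr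
    _ = 642432 * (L : ℝ) ^ 4 * ‖a' - A‖ ^ 2 := by rw [hM]; ring

end Summit.QuantumFields.YangMills.Theorems.SwapVirialDeficit.Gnomonic

end
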